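import Literature.AlgebraicGeometry.HodgeTheory.WeilClassesSixfolds
import HarnessLib

/-!
# Weil classes on abelian sixfolds of SPLIT Weil type are algebraic (Markman 2025, Thm. 1.5.1)

STATUS (2026-08-16): this theorem was vendored TWICE within minutes by two grounder seats in the
IDENTICAL rendering — first as `Markman2025_weilClasses_algebraic_hyperbolicSixfold` (file
`WeilClassesSixfolds`, p85530), then here (p85987). To keep ONE named fact (one unit of fact debt,
one hypothesis name for consumers) this file no longer declares a `def`: it imports the sibling and
records, as `Iff.rfl` theorems, that the spelling reviewed here IS that fact. CONSUMERS TAKE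
`(h : Markman2025_weilClasses_algebraic_hyperbolicSixfold)`. The source reading below stands as a
second, independent page-level check of the rendering.

Family `hodge`, layer `Literature/AlgebraicGeometry/HodgeTheory`. The sixfold half of Markman's
theorem, deliberately left out of the sibling file `WeilClassesFourfolds` ("NOT vendored: the sixfold
half of Thm. 1.2 / Thm. 1.5.1 ('split Weil type' = discriminant `-1` needs a Riemann form on
`H₁(A(ℂ), ℚ)` to instantiate `Motives.weilDiscriminant`)"), stated now that the tree renders
"discriminant `(-1)ⁿ`" on the real carriers as HYPERBOLICITY of the polarization pairing
(`Motives.IsHyperbolicWeilType`, file `Motives/HyperbolicWeilType`: a `φ^*`-stable rational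
`Q_h`-Lagrangian `2n`-frame of `H¹(A(ℂ); ℂ)`; by van Geemen 5.2/5.4 and Landherr this is
`det H = (-1)ⁿ ∈ ℚ^×/Nm(K^×)` for a polarized abelian `2n`-fold of Weil type — module docstring there,
§"Why this is van Geemen's hyperbolicity"). For sixfolds `n = 3` and `(-1)³ = -1`: "split Weil type"
= "discriminant `-1`" = hyperbolic.

Source READ (held, `paper:arxiv-2502.03415`, text chunk 7): E. Markman, *Cycles on abelian 2n-folds
of Weil type from secant sheaves on abelian n-folds*, arXiv:2502.03415 (2025), **Theorem 1.5.1**,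
verbatim: "Let `d` be a positive integer. Set `K := ℚ(√-d)`. The Hodge-Weil classes of polarized
abelian sixfolds of Weil type with complex multiplication by `K` and with discriminant `-1` are
algebraic." (§1.1, chunk 3: "The determinant of the matrix of `H`, with respect to some `K`-basis of
`H₁(A,ℚ)`, is an element of `ℚ^×` and its image in `ℚ^×/Nm(K^×)` is called the discriminant `det H`
of `(A,η,h)`"; Lemma 3.1.3, chunk 19: "Then the discriminant of the hermitian form `H` is `(-1)ⁿ`".)
Also E. Markman, *Secant sheaves and Weil classes on abelian varieties*, arXiv:2509.23403, Thm. 1.2: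
"The Weil classes for abelian fourfolds of Weil type and abelian sixfolds of split Weil type with
complex multiplication by a quadratic imaginary number field `K` are algebraic."

## Rendering (same conventions as `Markman2025_weilClasses_algebraic_abelianFourfold`)

* `A : Motives.AbelianVariety ℂ` with `A.dim = 2 * 3`, smooth projective, `φ : A ⟶ A` with
  `φ ≫ φ = -(d • 𝟙 A)`, `0 < d` (so `K = ℚ(√-d) = ℚ + ℚφ ↪ End⁰(A)`).
* The POLARIZATION is an argument, as print's "`(A, η, h)`" and as in `IsHyperbolicWeilType`: for a
  projective embedding `e : A.X ↪ ℙᴺ` and a non-zero rational class `a ∈ H²(ℙᴺ(ℂ); ℂ)` (a rational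
  multiple of the hyperplane class), `h := d · e^*a + φ^*(e^*a)` is the `K`-symmetrised hyperplane
  class: `φ^* h = d · h` (since `(φ^*)² = d²` on `H² = ⋀²H¹`), and `± h` is the class of an ample,
  `K`-compatible polarization `E` (`e^*a` is `±` ample, `φ` is an isogeny); conversely every
  `K`-compatible polarization `E` of `A` gives such an `h = 2d·q·cl(E)` after a very ample multiple,
  and `IsHyperbolicWeilType` is insensitive to `h ↦ c h` (`isHyperbolicWeilType_smul_iff`). This is the
  typing of the route decl `HeckePrymWeil.HyperbolicEightfoldsSqrtMinus7` (eightfolds, `d = 7`).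
* "discriminant `-1`" is `Motives.IsHyperbolicWeilType A φ 3 h` (dictionary above; `h` is a genuine
  polarization class here, so `Q_h` is non-degenerate on `H¹` and the Lagrangian frame is van Geemen's
  Witt-index-`3` subspace).
* "Hodge–Weil classes" = rational classes of type `(3,3)` in the Weil plane
  `weilClassesOf A φ 3 d = E₊ ⊔ E₋ ⊆ H⁶(A(ℂ); ℂ)` (van Geemen 4.9, `⋀⁶_K H¹ ⊗ ℂ`; cut out by ALL the
  pull-backs `(x·𝟙 + y·φ)^*`, so no coincidence of eigenvalues can enlarge it).
* "of Weil type" (multiplicities `(3,3)` of `K` on `H^{1,0}`) is not a separate hypothesis: if `(A, K)`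
  is not of Weil type then `E₊ = ⋀⁶V₊`, `E₋ = ⋀⁶V₋` have pure Hodge types `(p, 6-p) ≠ (3,3)` and
  `(6-p, p)`, a class of type `(3,3)` in `E₊ ⊕ E₋` is `0`, and the conclusion is trivial — exactly as
  explained in `WeilClassesFourfolds`; so the rendering never claims more than print.

## What this grounds

The clause "dim 6 split = Markman2025SecantWeil Thm 1.5.1 (settled)" of the route decls
`HeckePrymWeil.HyperbolicEightfoldsSqrtMinus7` of the Hodge summit (statement item 14642) and
`HeckePrymWeil.WeilSixfoldsSqrtMinus7` (item 1260, its split half), and the stub `SplitSixfolds` of the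
crux folder `HodgeAbelianVarieties`. Users take
`(h : Markman2025_weilClasses_algebraic_hyperbolicSixfold)` (the sibling's name).

## Not here

The proof (semiregular secant² sheaves on `X × X̂`, `X` a Jacobian of genus 3; Buchweitz–Flenner
semiregularity); Landherr's theorem; the `n ≥ 4` analogue (not known: "the proof of their semiregularity is
special to genus 3", loc. cit. after Thm. 1.5.1).
-/

noncomputable section

open CategoryTheory

namespace Literature.AlgebraicGeometry.HodgeTheory

open Literature.AlgebraicTopology.SingularHomology

section HodgeTheory

/-- **Markman 2025, Theorem 1.5.1 (arXiv:2502.03415; = arXiv:2509.23403 Thm. 1.2, sixfold half)**, the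
spelling checked in this file, is DEFINITIONALLY the first-landed named fact
`Markman2025_weilClasses_algebraic_hyperbolicSixfold` (file `WeilClassesSixfolds`): for `0 < d`, `A` a
smooth projective complex abelian variety of dimension `6` with `φ ≫ φ = -(d • 𝟙 A)`, a projective
embedding `e` and a non-zero rational `a ∈ H²(ℙᴺ(ℂ); ℂ)` such that `(A, φ)` is hyperbolic for the
`K`-symmetrised hyperplane class `h = d · e^*a + φ^*(e^*a)` (`Motives.IsHyperbolicWeilType A φ 3 h`, i.e.
`det H = (-1)³ = -1`), every rational class of Hodge type `(3,3)` in the Weil plane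
`weilClassesOf A φ 3 d` lies in `algebraicClasses A.X 3`. Use the sibling's name as the hypothesis; this
`Iff.rfl` only certifies that the two independent renderings agree symbol by symbol.
[cite: Markman2025SecantWeil, Thm. 1.5.1 (with §1.1 and Lemma 3.1.3 for the discriminant)]
[cite: Markman2025SurveySecant, Thm. 1.2]
[cite: vanGeemen1994HodgeAV, 4.9, Lemma 5.2 and 5.4 (5.4.1)] -/
theorem Markman2025_weilClasses_algebraic_abelianSixfold_split_iff :
    Markman2025_weilClasses_algebraic_hyperbolicSixfold ↔
      ∀ (d : ℕ), 0 < d → ∀ (A : Motives.AbelianVariety ℂ) (φ : A ⟶ A), A.dim = 2 * 3 →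
        Motives.IsSmoothProjective (2 * 3) A.X → φ ≫ φ = -(d • 𝟙 A) →
          ∀ (e : Motives.ProjectiveEmbedding A.X) (a : complexBetti (Motives.projectiveSpace e.n ℂ) 2),
            IsRationalClass a → a ≠ 0 →
              Motives.IsHyperbolicWeilType A φ 3
                ((d : ℂ) • complexBetti.map e.ι 2 a +
                  complexBetti.map φ.hom.hom.hom 2 (complexBetti.map e.ι 2 a)) →
                ∀ c : complexBetti A.X (2 * 3), IsRationalClass c →
                  IsOfHodgeType (2 * 3) A.X (2 * 3) 3 3 c → c ∈ weilClassesOf A φ 3 d →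
                    c ∈ algebraicClasses A.X 3 :=
  Iff.rfl

/-! ### Upper bound

The fact is an instance of the summit statement: `Markman2025_weilClasses_algebraic_hyperbolicSixfold_of_hodgeConjectureFor`
(file `WeilClassesSixfolds`). -/

/-! The trivially inhabited instance `c = 0` is `zero_mem_weilClassesOf_and_algebraicClasses A φ 3 d`
(file `WeilClassesFourfolds`) / `zero_mem_weilClassesOf_three_and_algebraicClasses` (file `WeilClassesSixfolds`). -/

end HodgeTheory

end Literature.AlgebraicGeometry.HodgeTheory
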